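import Mathlib.Analysis.Analytic.IsolatedZeros
import Mathlib.Analysis.SpecialFunctions.Complex.Analytic
import Mathlib.Analysis.SpecialFunctions.Pow.Deriv
import Mathlib.Analysis.Complex.CauchyIntegral

/-!
# Local normal form of a non-constant holomorphic function

Crux `WitnessCharge` (item stmt-SmoothPoincare4-7824, route route-SmoothPoincare4-SullivanDual),
line `Sketch`, stub `helper_localNormalForm`.

If `f : ℂ → ℂ` is analytic at `z₀` and not locally constant there, then near `z₀` it has the form
`f z = f z₀ + (φ z) ^ n` with `n ≥ 1` and `φ` a local holomorphic coordinate at `z₀`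
(`φ` analytic at `z₀`, `φ z₀ = 0`, `deriv φ z₀ ≠ 0`); moreover `n = 1` exactly when
`deriv f z₀ ≠ 0` (Conway, *Functions of One Complex Variable I*, VII §4; Rudin, *Real and Complex
Analysis*, Thm 10.32).  Proof: the isolated-zeros factorisation
`f z - f z₀ = (z - z₀) ^ n • h z` with `h` analytic at `z₀` and `h z₀ ≠ 0`
(`AnalyticAt.exists_eventuallyEq_pow_smul_nonzero_iff`), a holomorphic `n`-th root
`ψ z = exp ((log (h z / h z₀) + log (h z₀)) / n)` of `h` near `z₀` (`h z₀ / h z₀ = 1` lies in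
`Complex.slitPlane`, where `Complex.log` is analytic), and `φ z = (z - z₀) * ψ z`.
-/

noncomputable section

set_option linter.dupNamespace false

open Set Filter Topology

namespace Summit.SmoothPoincare4.SmoothPoincare4.Theorems.WitnessCharge.PencilIncompleteness

/-- **Holomorphic `n`-th root of a non-vanishing analytic germ.** If `h` is analytic at `z₀` with
`h z₀ ≠ 0` and `n ≠ 0`, then there is `ψ`, analytic at `z₀` and nowhere zero, with
`ψ z ^ n = h z` for all `z` near `z₀`; explicitly `ψ z = exp ((log (h z / h z₀) + log (h z₀)) / n)`,
which is analytic at `z₀` because `h z₀ / h z₀ = 1 ∈ Complex.slitPlane`. -/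
theorem helper_localNormalForm_nthRoot {h : ℂ → ℂ} {z₀ : ℂ} (hh : AnalyticAt ℂ h z₀)
    (h0 : h z₀ ≠ 0) {n : ℕ} (hn : n ≠ 0) :
    ∃ ψ : ℂ → ℂ, AnalyticAt ℂ ψ z₀ ∧ (∀ z, ψ z ≠ 0) ∧ ∀ᶠ z in 𝓝 z₀, ψ z ^ n = h z := by
  refine ⟨fun z => Complex.exp ((Complex.log (h z / h z₀) + Complex.log (h z₀)) / n),
    ?_, fun z => Complex.exp_ne_zero _, ?_⟩
  · have h1 : AnalyticAt ℂ (fun z => Complex.log (h z / h z₀)) z₀ :=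
      hh.div_const.clog (by simp [h0])
    exact (h1.add analyticAt_const).div_const.cexp'
  · filter_upwards [hh.continuousAt.eventually_ne h0] with z hz
    rw [← Complex.exp_nat_mul, mul_div_cancel₀ _ (Nat.cast_ne_zero.mpr hn), Complex.exp_add,
      Complex.exp_log (div_ne_zero hz h0), Complex.exp_log h0, div_mul_cancel₀ _ h0]

/-- **Local normal form of a non-constant holomorphic function.** Let `f : ℂ → ℂ` be analytic at
`z₀` and not eventually equal to `f z₀` near `z₀`. Then there are `n ≥ 1` and a local holomorphic
coordinate `φ` at `z₀` (`φ` analytic at `z₀`, `φ z₀ = 0`, `deriv φ z₀ ≠ 0`) with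
`f z = f z₀ + (φ z) ^ n` for all `z` near `z₀`, and `n = 1 ↔ deriv f z₀ ≠ 0`.
Proof: write `f z - f z₀ = (z - z₀) ^ n • h z` with `h` analytic, `h z₀ ≠ 0`
(`AnalyticAt.exists_eventuallyEq_pow_smul_nonzero_iff`); `n ≠ 0` since the left side vanishes at
`z₀`; take a holomorphic `n`-th root `ψ` of `h` near `z₀` (`helper_localNormalForm_nthRoot`) and
put `φ z = (z - z₀) * ψ z`, so `deriv φ z₀ = ψ z₀ ≠ 0`; finally
`deriv f z₀ = n * φ z₀ ^ (n - 1) * deriv φ z₀`, which is nonzero iff `n = 1`. -/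
theorem helper_localNormalForm :
    ∀ (f : ℂ → ℂ) (z₀ : ℂ), AnalyticAt ℂ f z₀ → (¬ ∀ᶠ z in 𝓝 z₀, f z = f z₀) →
      ∃ (n : ℕ) (φ : ℂ → ℂ), 0 < n ∧ AnalyticAt ℂ φ z₀ ∧ φ z₀ = 0 ∧ deriv φ z₀ ≠ 0 ∧
        (∀ᶠ z in 𝓝 z₀, f z = f z₀ + (φ z) ^ n) ∧ (n = 1 ↔ deriv f z₀ ≠ 0) := by
  intro f z₀ hf hnc
  -- isolated-zeros factorisation of `z ↦ f z - f z₀`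
  have hg : AnalyticAt ℂ (fun z => f z - f z₀) z₀ := hf.sub analyticAt_const
  have hgnc : ¬ ∀ᶠ z in 𝓝 z₀, f z - f z₀ = 0 := by simpa only [sub_eq_zero] using hnc
  obtain ⟨n, h, hh, h0, hfac⟩ := hg.exists_eventuallyEq_pow_smul_nonzero_iff.mpr hgnc
  have hn : n ≠ 0 := by
    rintro rfl
    have h00 := hfac.self_of_nhds
    simp only [sub_self, pow_zero, one_smul] at h00
    exact h0 h00.symm
  -- holomorphic `n`-th root of `h` and the local coordinate `φ z = (z - z₀) * ψ z`
  obtain ⟨ψ, hψ, hψ0, hroot⟩ := helper_localNormalForm_nthRoot hh h0 hn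
  have hφ : AnalyticAt ℂ (fun z => (z - z₀) * ψ z) z₀ :=
    (analyticAt_id.sub analyticAt_const).mul hψ
  have hdφ : HasDerivAt (fun z => (z - z₀) * ψ z) (ψ z₀) z₀ := by
    have hd := ((hasDerivAt_id z₀).sub_const z₀).fun_mul hψ.differentiableAt.hasDerivAt
    simpa only [id_eq, sub_self, one_mul, zero_mul, add_zero] using hd
  have hφn : ∀ᶠ z in 𝓝 z₀, f z = f z₀ + ((z - z₀) * ψ z) ^ n := by
    filter_upwards [hfac, hroot] with z hz hr
    rw [smul_eq_mul] at hz
    rw [mul_pow, hr, ← hz]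
    ring
  refine ⟨n, fun z => (z - z₀) * ψ z, Nat.pos_of_ne_zero hn, hφ, by simp, ?_, hφn, ?_⟩
  · rw [hdφ.deriv]
    exact hψ0 z₀
  -- the derivative of `f` at `z₀` read off from the normal form
  have hdf : HasDerivAt f (↑n * ((z₀ - z₀) * ψ z₀) ^ (n - 1) * ψ z₀) z₀ :=
    ((hdφ.fun_pow n).const_add (f z₀)).congr_of_eventuallyEq hφn
  rw [hdf.deriv, sub_self, zero_mul]
  constructor
  · rintro rfl
    simpa using hψ0 z₀
  · intro h1
    by_contra hne
    exact h1 (by rw [zero_pow (by omega), mul_zero, zero_mul])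

end Summit.SmoothPoincare4.SmoothPoincare4.Theorems.WitnessCharge.PencilIncompleteness
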